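import Summits.RiemannHypothesis.RiemannHypothesis.Theorems.ThetaTier2CellStep
import HarnessLib

/-!
# THETA tier-2 kernel checker — the loop invariant over `cellLoop` (cc-s2-1, WEIL typing lane; RH-FREE)

(K1), loop level, part 1 (HOME/cc-s2-1/gen22/TIER2-KERNEL-SPEC.md §6): `cellLoop A fuel j st` preserves the enclosure invariant `CellInv`
(`cellLoop_inv`), provided the θ-interval lower ends stay positive — which follows from the two decidable data facts `0 < st.lo` and `S ≤ A.etL`
(`e^τ ≥ 1`, so `mulD lo etL ≥ lo`: `le_mulD_of_S_le`).  Also the unfolding equations `cellLoop_zero` / `cellLoop_succ` (by `unfold`, see the kernel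
note in `ThetaTier2Harm`) and the monotonicity of the upper ends (`le_mulU_of_S_le`), from which the size side condition `K·val hi_j ≤ 2²⁴` for every
cell follows from its value at the last cell.  The per-cell envelope bounds are `cellStep_S/e/ep` (ThetaTier2CellStep); collecting them along the
reversed lists is part 2.  Nothing here bears on the truth of RH.
-/

set_option linter.dupNamespace false  -- the mandated namespace repeats `RiemannHypothesis`
set_option autoImplicit false

namespace Summit.RiemannHypothesis.RiemannHypothesis.Theorems.ThetaTier2

open Real

/-- `cellLoop` with no fuel is the identity. [this cell] -/
theorem cellLoop_zero (A : Inp) (j : ℕ) (st : St) : cellLoop A 0 j st = st := by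
  unfold cellLoop; rfl

/-- One step of `cellLoop`. [this cell] -/
theorem cellLoop_succ (A : Inp) (fuel j : ℕ) (st : St) :
    cellLoop A (fuel + 1) j st = cellLoop A fuel (j + 1) (cellStep A j st) := by
  conv => lhs; unfold cellLoop

/-- `mulD` by a factor `≥ 1` (i.e. `S ≤ e`) does not decrease: `lo ≤ mulD lo e`. [this cell] -/
theorem le_mulD_of_S_le {lo e : ℕ} (he : S ≤ e) : lo ≤ mulD lo e := by
  unfold mulD
  have hS : 0 < S := by rw [S_eq_two_pow]; positivity
  exact (Nat.le_div_iff_mul_le hS).2 (Nat.mul_le_mul_left lo he)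

/-- `mulU` by a factor `≥ 1` does not decrease: `hi ≤ mulU hi e`. [this cell] -/
theorem le_mulU_of_S_le {hi e : ℕ} (he : S ≤ e) : hi ≤ mulU hi e := by
  unfold mulU
  have hS : 0 < S := by rw [S_eq_two_pow]; positivity
  exact (Nat.le_div_iff_mul_le hS).2 (by nlinarith [Nat.mul_le_mul_left hi he])

/-- The lower end after a step (a field that does not depend on the harmonic sums). [this cell] -/
theorem cellStep_lo (A : Inp) (j : ℕ) (st : St) : (cellStep A j st).lo = mulD st.lo A.etL := by
  unfold cellStep
  dsimp only

/-- The lower end after a step stays positive. [this cell] -/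
theorem cellStep_lo_pos (A : Inp) (j : ℕ) (st : St) (hlo : 0 < st.lo) (he : S ≤ A.etL) : 0 < (cellStep A j st).lo := by
  have h := le_mulD_of_S_le (lo := st.lo) he
  rw [cellStep_lo]; omega

/-- **The loop preserves the invariant**: `CellInv` at `j` ⇒ `CellInv` at `j + fuel` for `cellLoop A fuel j st` (with `S ≤ A.etL`).
[this cell, TIER2-KERNEL-SPEC §2 (E3)] -/
theorem cellLoop_inv (A : Inp) {θ₀ τ M₀ M₁₀ c₂ ε R Rm : ℝ} (hA : CellAtoms A θ₀ τ M₀ M₁₀ c₂ ε R Rm) (he : S ≤ A.etL) :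
    ∀ fuel j : ℕ, ∀ st : St, CellInv A θ₀ τ j st → CellInv A θ₀ τ (j + fuel) (cellLoop A fuel j st) := by
  intro fuel
  induction fuel with
  | zero => intro j st h; rw [cellLoop_zero]; simpa using h
  | succ fuel ih =>
    intro j st h
    rw [cellLoop_succ]
    have h1 : CellInv A θ₀ τ (j + 1) (cellStep A j st) :=
      cellStep_inv A hA h (by have := cellStep_lo_pos A j st h.lo_pos he; rwa [cellStep_lo] at this)
    have := ih (j + 1) (cellStep A j st) h1
    rwa [show j + 1 + fuel = j + (fuel + 1) by omega] at this

/-- The initial state of `stage1` satisfies the invariant at `j = 0` when `θ₀ ∈ [val th0L, val th0H]` and `0 < th0L`. [this cell] -/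
theorem stage1_init_inv (A : Inp) {θ₀ τ : ℝ} (h1 : val A.th0L ≤ θ₀) (h2 : θ₀ ≤ val A.th0H) (h0 : 0 < A.th0L) :
    CellInv A θ₀ τ 0 { lo := A.th0L, hi := A.th0H, emh := S, em := S, em1 := S, eh := S, eRev := [], epRev := [], sRev := [] } := by
  refine ⟨?_, ?_, h0, ?_, ?_, ?_, ?_⟩ <;> simp [val_S, h1, h2]

/-- **`stage1` ends with the invariant at `Jt`.** [this cell] -/
theorem stage1_inv (A : Inp) {θ₀ τ M₀ M₁₀ c₂ ε R Rm : ℝ} (hA : CellAtoms A θ₀ τ M₀ M₁₀ c₂ ε R Rm) (he : S ≤ A.etL)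
    (h1 : val A.th0L ≤ θ₀) (h2 : θ₀ ≤ val A.th0H) (h0 : 0 < A.th0L) :
    CellInv A θ₀ τ A.Jt (stage1 A) := by
  have := cellLoop_inv A hA he A.Jt 0 _ (stage1_init_inv A (τ := τ) h1 h2 h0)
  rw [Nat.zero_add] at this
  unfold stage1
  exact this

end Summit.RiemannHypothesis.RiemannHypothesis.Theorems.ThetaTier2
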